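import Mathlib
import HarnessLib
import Summits.HubbardSuperconductivity.HubbardSuperconductivity.Theorems.KLProgrammeC4aValueBridgeGeometry
import Summits.HubbardSuperconductivity.HubbardSuperconductivity.Theorems.KLProgrammeC4aOddPairing

/-!
# Route `KLProgramme` — crux C4a, value layer (L3-val): the angular average of a pair-momentum vertex RECENTRED at the Cooper angle, the
# LEVEL-DIFFERENCE as a double integral (fundamental theorem in the level + Fubini), and the `|φ|^{−1/2}` window integral

Cell `gate-hubbard-kl`, lane hubbard-kl-k3c3-p3 (g14); helper for stub (C) `stub_twoLeg_curvature` of `KLRegimeEngineV17F2` (stmt-HubbardSuperconductivity-20437),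
`k = 0` VALUE clause (located risk #12 «(C)-VALUE-K0»; (L3-val) input (ii) of HOME/hubbard-kl-c4a-1/C4A-PLAN.md §22.3).  Fourth file of the
«(L3-val)-EVEN-BRIDGE» bundle (`…Geometry` → `…PV` → `…PVIntegral`; this file is independent of the last two and feeds the assembly `…C4aValueBridge`).

* §1 `setIntegral_abs_rpow_neg_half` — `∫_{(−π,π)} |φ|^{−1/2} dφ = 4√π` (the window integral of the VALUE majorant `cb₀ + cbh·(max(c′‖p‖,Λ))^{−1/2}` along a
  level curve, through the lower comparability `‖S‖ ≥ c|φ|`; a `log(1/max(c′‖p‖,Λ))` majorant converts by `log x ≤ 2√x`);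
* §2 `tubeAngularAvg_pairSum_eq_recentre` — `tubeAngularAvg μ K (k,q ↦ B(k+q)) θ ρ = ∫_{(−π,π)} J(ρ,π+φ+θ) • B(S_{ρ,π+φ,θ}(0)) dφ`;
* §3 the LEVEL PATH: chain rule `∂_σ B(S_{σ,ψ,θ}(0)) = DB(S_σ)[∂_σS_σ]`, joint continuity of `(φ,σ) ↦ DB(S_{σ,π+φ,θ}(0))[toLp(∂_μu(σ,π+φ+θ)•dir(π+φ+θ))]`
  on `ℝ × (−r,r)`, the fundamental theorem `B(S_s(φ)) − B(S_{−s}(φ)) = ∫_{−s}^{s} DB(S_σ(φ))[∂_σS_σ(φ)] dσ`, and FUBINI on the box `(−π,π) × (−s,s]`.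

Pure real analysis on the tree's chart objects; nothing about the Hubbard model's sizes; nothing asserts superconductivity.
References: BGM 2006 §2.4 (2.36) [cite: BenfattoGiulianiMastropietro2006].
-/

noncomputable section

namespace Summit.HubbardSuperconductivity.HubbardSuperconductivity.Theorems.C4a

set_option linter.dupNamespace false -- summit = problem name (single-conjunct summit), D-0017

open Real Set MeasureTheory Filter
open scoped ContDiff Topology
open Literature.MathematicalPhysics.QuantumLattice Literature.MathematicalPhysics.QuantumLattice.BandSectorCounting Literature.Probability.LatticeModels
open Summit.HubbardSuperconductivity.HubbardSuperconductivity.Theorems.KLRegimeSplit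
open Summit.HubbardSuperconductivity.HubbardSuperconductivity.Theorems.DispersionFlow
open Summit.HubbardSuperconductivity.HubbardSuperconductivity.Theorems.PerturbedFermiCurve

/-! ## §1 The window integral of `|φ|^{−1/2}` -/

/-- `∫_0^π φ^{−1/2} dφ = 2√π`. -/
theorem integral_rpow_neg_half_zero_pi : ∫ φ in (0 : ℝ)..π, φ ^ (-(1 / 2 : ℝ)) = 2 * Real.sqrt π := by
  rw [integral_rpow (Or.inl (by norm_num))]
  have h1 : (-(1 / 2 : ℝ)) + 1 = 1 / 2 := by norm_num
  rw [h1, Real.zero_rpow (by norm_num), sub_zero, Real.sqrt_eq_rpow]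
  ring

/-- **The window integral of the value majorant's singular part**: `∫_{(−π,π)} |φ|^{−1/2} dφ = 4√π`. -/
theorem setIntegral_abs_rpow_neg_half : ∫ φ in Ioo (-π) π, |φ| ^ (-(1 / 2 : ℝ)) = 4 * Real.sqrt π := by
  have hπ := Real.pi_pos
  set g : ℝ → ℝ := fun φ => |φ| ^ (-(1 / 2 : ℝ)) with hg
  have hint : ∀ a b : ℝ, IntervalIntegrable g volume a b := by
    intro a b
    -- `g` agrees with `x ↦ x^r` on `[0, ∞)` and with `x ↦ (−x)^r` on `(−∞, 0]`; both are interval integrable for `r > −1`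
    have hpos : ∀ c : ℝ, 0 ≤ c → IntervalIntegrable g volume 0 c := fun c hc => by
      refine (intervalIntegral.intervalIntegrable_rpow' (a := 0) (b := c) (by norm_num : (-1 : ℝ) < -(1 / 2))).congr ?_
      rw [Set.uIoc_of_le hc]
      intro x hx
      simp only [hg, abs_of_pos hx.1]
    have hneg : ∀ c : ℝ, 0 ≤ c → IntervalIntegrable g volume (-c) 0 := fun c hc => by
      have h := (IntervalIntegrable.iff_comp_neg).1 (hpos c hc)
      rw [neg_zero] at h
      have h' : IntervalIntegrable g volume 0 (-c) := h.congr fun x _ => by show g (-x) = g x; simp only [hg, abs_neg]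
      exact h'.symm
    have h0 : ∀ c : ℝ, IntervalIntegrable g volume 0 c := fun c => by
      rcases le_total 0 c with hc | hc
      · exact hpos c hc
      · have := (hneg (-c) (by linarith)); rw [neg_neg] at this; exact this.symm
    exact (h0 a).symm.trans (h0 b)
  have h1 : ∫ φ in (0 : ℝ)..π, g φ = 2 * Real.sqrt π := by
    rw [← integral_rpow_neg_half_zero_pi]
    refine intervalIntegral.integral_congr fun x hx => ?_
    rw [Set.uIcc_of_le hπ.le] at hx
    simp only [hg, abs_of_nonneg hx.1]
  have h2 : ∫ φ in (-π : ℝ)..0, g φ = 2 * Real.sqrt π := by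
    have h := intervalIntegral.integral_comp_neg (a := 0) (b := π) g
    rw [neg_zero] at h
    rw [← h1, ← h]
    refine intervalIntegral.integral_congr fun x _ => ?_
    simp only [hg, abs_neg]
  rw [← integral_Ioc_eq_integral_Ioo, ← intervalIntegral.integral_of_le (by linarith),
    ← intervalIntegral.integral_add_adjacent_intervals (hint (-π) 0) (hint 0 π), h1, h2]
  ring

/-- `|φ|^{−1/2}` is integrable on the window. -/
theorem integrableOn_abs_rpow_neg_half : IntegrableOn (fun φ : ℝ => |φ| ^ (-(1 / 2 : ℝ))) (Ioo (-π) π) := by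
  have h : (∫ φ in Ioo (-π) π, |φ| ^ (-(1 / 2 : ℝ))) ≠ 0 := by
    rw [setIntegral_abs_rpow_neg_half]; positivity
  exact MeasureTheory.Integrable.of_integral_ne_zero h

/-! ## §2 The angular average of a pair-sum vertex, recentred at the Cooper angle -/

/-- **RECENTRING**: for `V(k,q) = B(k+q)`, `tubeAngularAvg μ K V θ ρ = ∫_{(−π,π)} J(ρ, π+φ+θ) • B(S_{ρ,π+φ,θ}(0)) dφ` (the loop-angle integrand
is `2π`-periodic; `…C4aOddPairing.setIntegral_Ioc_two_pi_eq_recentre` at the centre `π + θ`). -/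
theorem tubeAngularAvg_pairSum_eq_recentre (μ : ℝ) (K : TrigPolyC4v) (Bf : Momentum → ℂ) (θ ρ : ℝ) :
    tubeAngularAvg μ K (fun k q => Bf (k + q)) θ ρ =
      ∫ φ in Ioo (-π) π, levelChartJac μ K (ρ, π + φ + θ) • Bf (pairSumPath μ K ρ (π + φ) θ 0) := by
  have hper : Function.Periodic (fun ϑ => levelChartJac μ K (ρ, ϑ) • Bf (levelPoint μ K 0 θ + levelPoint μ K ρ ϑ)) (2 * π) := fun ϑ => by
    simp only [levelChartJac_periodic μ K ρ ϑ, levelPoint_add_two_pi]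
  rw [tubeAngularAvg_apply, setIntegral_Ioc_two_pi_eq_recentre hper (π + θ)]
  refine setIntegral_congr_fun measurableSet_Ioo fun φ _ => ?_
  simp only [pairSumPath_apply_zero, add_right_comm π θ φ]

section Level

variable {a b : ℝ} (B : BandBounds a b) {K : TrigPolyC4v} {A : ℝ}
  (hA : ∀ p : Momentum, ∀ j ≤ 2, ‖iteratedFDeriv ℝ j (frameShift K) p‖ ≤ A) (hADt : 2 * A < B.Dtmin)
  {μ r : ℝ} (hlo : a < μ - r - A) (hhi : μ + r + A < b)
include B hA hADt hlo hhi

/-! ## §3 The level path: chain rule, joint continuity, the fundamental theorem, Fubini -/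

/-- **Chain rule along the level**: `σ ↦ B(S_{σ,ψ,θ}(0))` has derivative `DB(S_σ)[toLp(∂_μu(σ,ψ+θ)•dir(ψ+θ))]` at every `|σ| < r` (`B ∈ C¹`). -/
theorem hasDerivAt_comp_pairSumPath_level {Bf : Momentum → ℂ} (hB : Differentiable ℝ Bf) {σ : ℝ} (hσ : σ ∈ Ioo (-r) r) (ψ θ : ℝ) :
    HasDerivAt (fun s : ℝ => Bf (pairSumPath μ K s ψ θ 0))
      ((fderiv ℝ Bf (pairSumPath μ K σ ψ θ 0))
        (WithLp.toLp 2 (deriv (fun m : ℝ => perturbedFermiRadius (fun k : Fin 2 → ℝ => -K.eval k) m (ψ + θ)) (μ + σ) • dir (ψ + θ)))) σ :=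
  (hB _).hasFDerivAt.comp_hasDerivAt σ (hasDerivAt_pairSumPath_level B hA hADt hlo hhi hσ ψ θ)

/-- **Joint continuity of the level-path integrand** on `ℝ × (−r, r)`:
`(φ, σ) ↦ DB(S_{σ,π+φ,θ}(0))[toLp(∂_μu(σ,π+φ+θ)•dir(π+φ+θ))]` (`B ∈ C¹`). -/
theorem continuousOn_fderiv_pairSumPath_levelVel {Bf : Momentum → ℂ} (hB : ContDiff ℝ 1 Bf) (θ : ℝ) :
    ContinuousOn (fun p : ℝ × ℝ => (fderiv ℝ Bf (pairSumPath μ K p.2 (π + p.1) θ 0))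
      (WithLp.toLp 2 (deriv (fun m : ℝ => perturbedFermiRadius (fun k : Fin 2 → ℝ => -K.eval k) m (π + p.1 + θ)) (μ + p.2) • dir (π + p.1 + θ))))
      (univ ×ˢ Ioo (-r) r) := by
  set T : Set (ℝ × ℝ) := {ρ : ℝ | |ρ| < r} ×ˢ (univ : Set ℝ) with hT
  set g : ℝ × ℝ → ℝ × ℝ := fun p => (p.2, π + p.1 + θ) with hg
  have hgc : Continuous g := by fun_prop
  have hmaps : MapsTo g (univ ×ˢ Ioo (-r) r) T := fun p hp =>
    mk_mem_prod (abs_lt.2 ⟨(mem_prod.1 hp).2.1, (mem_prod.1 hp).2.2⟩) (mem_univ _)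
  -- the chart point and the pair-sum path
  have hΦ : ContinuousOn (fun q : ℝ × ℝ => levelPoint μ K q.1 q.2) T := (contDiffOn_levelPoint B hA hADt hlo hhi (m := 0)).continuousOn
  have hS : ContinuousOn (fun p : ℝ × ℝ => pairSumPath μ K p.2 (π + p.1) θ 0) (univ ×ˢ Ioo (-r) r) := by
    have h := hΦ.comp hgc.continuousOn hmaps
    simp only [pairSumPath_apply_zero]
    exact continuousOn_const.add (h.congr fun p _ => by simp [hg])
  have hDB : ContinuousOn (fun p : ℝ × ℝ => fderiv ℝ Bf (pairSumPath μ K p.2 (π + p.1) θ 0)) (univ ×ˢ Ioo (-r) r) :=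
    (hB.continuous_fderiv (by norm_num)).comp_continuousOn hS
  -- the velocity coefficient `∂_μu = J/u` is jointly continuous on the tube
  have hJ : ContinuousOn (levelChartJac μ K) T := (contDiffOn_levelChartJac B hA hADt hlo hhi).continuousOn
  have hu : ContinuousOn (fun q : ℝ × ℝ => perturbedFermiRadius (fun k : Fin 2 → ℝ => -K.eval k) (μ + q.1) q.2) T :=
    (contDiffOn_levelRadius_tube B hA hADt hlo hhi).continuousOn
  have hune : ∀ q ∈ T, perturbedFermiRadius (fun k : Fin 2 → ℝ => -K.eval k) (μ + q.1) q.2 ≠ 0 := fun q hq => by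
    have hρ : |q.1| < r := (mem_prod.1 hq).1
    exact (levelRadius_pos B hA (by have := (abs_lt.1 hρ).1; linarith) (by have := (abs_lt.1 hρ).2; linarith) q.2).ne'
  have hcoefT : ContinuousOn (fun q : ℝ × ℝ => deriv (fun m : ℝ => perturbedFermiRadius (fun k : Fin 2 → ℝ => -K.eval k) m q.2) (μ + q.1)) T := by
    refine (hJ.div hu hune).congr fun q hq => ?_
    have hρ : |q.1| < r := (mem_prod.1 hq).1
    exact deriv_levelRadius_level_eq_jac_div B hA hlo hhi ⟨(abs_lt.1 hρ).1, (abs_lt.1 hρ).2⟩ q.2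
  have hcoef : ContinuousOn (fun p : ℝ × ℝ => deriv (fun m : ℝ => perturbedFermiRadius (fun k : Fin 2 → ℝ => -K.eval k) m (π + p.1 + θ)) (μ + p.2))
      (univ ×ˢ Ioo (-r) r) := (hcoefT.comp hgc.continuousOn hmaps).congr fun p _ => by simp [hg]
  have hdir : Continuous fun p : ℝ × ℝ => dir (π + p.1 + θ) := (contDiff_dir (n := 0)).continuous.comp (by fun_prop)
  have hvec : ContinuousOn (fun p : ℝ × ℝ => (WithLp.toLp 2 (deriv (fun m : ℝ => perturbedFermiRadius (fun k : Fin 2 → ℝ => -K.eval k) m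
      (π + p.1 + θ)) (μ + p.2) • dir (π + p.1 + θ)) : Momentum)) (univ ×ˢ Ioo (-r) r) :=
    (PiLp.continuousLinearEquiv 2 ℝ (fun _ : Fin 2 => ℝ)).symm.continuous.comp_continuousOn (hcoef.smul hdir.continuousOn)
  exact hDB.clm_apply hvec

/-- **THE LEVEL DIFFERENCE AS AN INTEGRAL** (fundamental theorem of calculus along the radial path): for `|s| < r`, `B ∈ C¹` and every `φ`,
`B(S_{s,π+φ,θ}(0)) − B(S_{−s,π+φ,θ}(0)) = ∫_{σ=−s}^{s} DB(S_{σ,π+φ,θ}(0))[toLp(∂_μu(σ,π+φ+θ)•dir(π+φ+θ))] dσ`. -/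
theorem apply_pairSumPath_sub_eq_intervalIntegral {Bf : Momentum → ℂ} (hB : ContDiff ℝ 1 Bf) {s : ℝ} (hs : |s| < r) (φ θ : ℝ) :
    Bf (pairSumPath μ K s (π + φ) θ 0) - Bf (pairSumPath μ K (-s) (π + φ) θ 0) =
      ∫ σ in (-s)..s, (fderiv ℝ Bf (pairSumPath μ K σ (π + φ) θ 0))
        (WithLp.toLp 2 (deriv (fun m : ℝ => perturbedFermiRadius (fun k : Fin 2 → ℝ => -K.eval k) m (π + φ + θ)) (μ + σ) • dir (π + φ + θ))) := by
  have hsub : Set.uIcc (-s) s ⊆ Ioo (-r) r := by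
    intro σ hσ
    rcases le_total (-s) s with h | h
    · rw [Set.uIcc_of_le h] at hσ; exact ⟨by linarith [(abs_lt.1 hs).2, hσ.1], by linarith [(abs_lt.1 hs).2, hσ.2]⟩
    · rw [Set.uIcc_of_ge h] at hσ; exact ⟨by linarith [(abs_lt.1 hs).1, hσ.1], by linarith [(abs_lt.1 hs).1, hσ.2]⟩
  have hderiv : ∀ σ ∈ Set.uIcc (-s) s, HasDerivAt (fun t : ℝ => Bf (pairSumPath μ K t (π + φ) θ 0))
      ((fderiv ℝ Bf (pairSumPath μ K σ (π + φ) θ 0))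
        (WithLp.toLp 2 (deriv (fun m : ℝ => perturbedFermiRadius (fun k : Fin 2 → ℝ => -K.eval k) m (π + φ + θ)) (μ + σ) • dir (π + φ + θ)))) σ :=
    fun σ hσ => hasDerivAt_comp_pairSumPath_level B hA hADt hlo hhi (hB.differentiable (by norm_num)) (hsub hσ) (π + φ) θ
  have hcont := continuousOn_fderiv_pairSumPath_levelVel B hA hADt hlo hhi hB θ
  have hslice := hcont.comp (Continuous.prodMk_right φ).continuousOn fun σ hσ => mk_mem_prod (mem_univ _) (hsub hσ)
  have hint : IntervalIntegrable (fun σ : ℝ => (fderiv ℝ Bf (pairSumPath μ K σ (π + φ) θ 0))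
      (WithLp.toLp 2 (deriv (fun m : ℝ => perturbedFermiRadius (fun k : Fin 2 → ℝ => -K.eval k) m (π + φ + θ)) (μ + σ) • dir (π + φ + θ))))
      volume (-s) s :=
    (hslice.intervalIntegrable (μ := volume)).congr fun σ _ => rfl
  exact (intervalIntegral.integral_eq_sub_of_hasDerivAt hderiv hint).symm

/-- **Integrability on the box and FUBINI**: for `s < r`, `|s₀| < r`, `B ∈ C¹`, the `J(s₀,·)`-weighted level-path integrand is integrable on
`(−π,π) × (−s, s]` and the two iterated integrals agree. -/
theorem setIntegral_setIntegral_swap_levelVel {Bf : Momentum → ℂ} (hB : ContDiff ℝ 1 Bf) {s₀ s : ℝ} (hs₀ : |s₀| < r) (hs : s < r) (θ : ℝ) :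
    ∫ φ in Ioo (-π) π, ∫ σ in Ioc (-s) s, (fderiv ℝ Bf (pairSumPath μ K σ (π + φ) θ 0))
        (levelChartJac μ K (s₀, π + φ + θ) •
          (WithLp.toLp 2 (deriv (fun m : ℝ => perturbedFermiRadius (fun k : Fin 2 → ℝ => -K.eval k) m (π + φ + θ)) (μ + σ) • dir (π + φ + θ)) :
            Momentum)) =
      ∫ σ in Ioc (-s) s, ∫ φ in Ioo (-π) π, (fderiv ℝ Bf (pairSumPath μ K σ (π + φ) θ 0))
        (levelChartJac μ K (s₀, π + φ + θ) •
          (WithLp.toLp 2 (deriv (fun m : ℝ => perturbedFermiRadius (fun k : Fin 2 → ℝ => -K.eval k) m (π + φ + θ)) (μ + σ) • dir (π + φ + θ)) :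
            Momentum)) := by
  have hs₀I : s₀ ∈ Ioo (-r) r := ⟨(abs_lt.1 hs₀).1, (abs_lt.1 hs₀).2⟩
  -- joint continuity of the weighted integrand on `ℝ × (−r, r)`
  have hG := continuousOn_fderiv_pairSumPath_levelVel B hA hADt hlo hhi hB θ
  have hJ : Continuous fun p : ℝ × ℝ => levelChartJac μ K (s₀, π + p.1 + θ) :=
    (continuous_levelChartJac_angle B hA hADt hlo hhi hs₀I).comp (by fun_prop)
  have hF' : ContinuousOn (fun p : ℝ × ℝ => levelChartJac μ K (s₀, π + p.1 + θ) • (fderiv ℝ Bf (pairSumPath μ K p.2 (π + p.1) θ 0))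
      (WithLp.toLp 2 (deriv (fun m : ℝ => perturbedFermiRadius (fun k : Fin 2 → ℝ => -K.eval k) m (π + p.1 + θ)) (μ + p.2) • dir (π + p.1 + θ))))
      (univ ×ˢ Ioo (-r) r) := hJ.continuousOn.smul hG
  have hK : IsCompact (Icc (-π) π ×ˢ Icc (-s) s) := isCompact_Icc.prod isCompact_Icc
  have hKsub : Icc (-π) π ×ˢ Icc (-s) s ⊆ univ ×ˢ Ioo (-r) r :=
    prod_mono (subset_univ _) fun σ hσ => ⟨by linarith [hσ.1], by linarith [hσ.2]⟩
  have hint : IntegrableOn (fun p : ℝ × ℝ => levelChartJac μ K (s₀, π + p.1 + θ) • (fderiv ℝ Bf (pairSumPath μ K p.2 (π + p.1) θ 0))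
      (WithLp.toLp 2 (deriv (fun m : ℝ => perturbedFermiRadius (fun k : Fin 2 → ℝ => -K.eval k) m (π + p.1 + θ)) (μ + p.2) • dir (π + p.1 + θ))))
      (Ioo (-π) π ×ˢ Ioc (-s) s) :=
    ((hF'.mono hKsub).integrableOn_compact hK).mono_set (prod_mono Ioo_subset_Icc_self Ioc_subset_Icc_self)
  rw [IntegrableOn, Measure.volume_eq_prod, ← Measure.prod_restrict] at hint
  have hint' : Integrable (Function.uncurry fun φ σ : ℝ => levelChartJac μ K (s₀, π + φ + θ) •
      (fderiv ℝ Bf (pairSumPath μ K σ (π + φ) θ 0))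
        (WithLp.toLp 2 (deriv (fun m : ℝ => perturbedFermiRadius (fun k : Fin 2 → ℝ => -K.eval k) m (π + φ + θ)) (μ + σ) • dir (π + φ + θ))))
      ((volume.restrict (Ioo (-π) π)).prod (volume.restrict (Ioc (-s) s))) := hint
  have hswap := MeasureTheory.integral_integral_swap hint'
  simp only [map_smul]
  exact hswap

end Level

end Summit.HubbardSuperconductivity.HubbardSuperconductivity.Theorems.C4a

end
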